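import Summits.CriticalPhenomena.PercolationContinuityZ3.Theorems.Transplant.FKConnectivityAllQCountReweightedDefs
import Literature.Probability.LatticeModels.RandomClusterFKG
import Literature.Probability.LatticeModels.RandomClusterComparison
import HarnessLib

/-!
# Cluster-COUNT-reweighted percolation `μ_{w,h} ∝ P_w·h(k)`: the FKG lattice condition, positive association, and monotonicity in the
# edge parameters for every NON-DECREASING LOG-CONVEX `h` — the class `𝓗` containing all `φ_{w,q}`, `q ≥ 1`

Support file (`--supports stmt-CriticalPhenomena-4575`), FK sub-lane `prim-bschramm-fk-1` (gen 10) of the post-continuity programme;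
builds on p205010 (kernel theorem, internal audit signed; external expert review pending).  No new definitions of statements, no named
facts, no sorries; standard axioms.  `crMeasure w h` (fk-1 g9) is the product measure `P_w` reweighted by `h(k(ω))`, `k` the number of
open clusters; `h(k) = q^k` is `φ_{w,q}` (`crMeasure_pow_eq_rcMeasureW`).

RESULTS.  For `h : ℕ → ℝ` POSITIVE, NON-DECREASING and LOG-CONVEX (`h(j+1)² ≤ h(j)·h(j+2)`):
* `logConvex_ratio_le`, `logConvex_shift_le`, `logConvex_supermodular_le` — the elementary inequalities: the ratios `h(j+1)/h(j)` are
  non-decreasing, hence `h(m)h(n) ≤ h(u)h(v)` whenever `u ≤ m ≤ n` and `m + n ≤ u + v`;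
* `crWeight_lattice_condition` — **the FKG lattice condition** `μ(a)μ(b) ≤ μ(a ∩ b)μ(a ∪ b)` for the weights `P_w(ω)h(k(ω))` (product part
  modular, `k` supermodular and antitone — Grimmett (3.11)–(3.12) — and the `h`-inequality above);
* `crMeasure_fkg` — **positive association**: `μ(A)μ(A') ≤ μ(A ∩ A')` for increasing events (Mathlib's four-functions `fkg`);
* `crMeasure_real_mono_weights` — **comparison in the edge parameters**: `w ≤ w'` pointwise ⇒ `μ_{w,h}(A) ≤ μ_{w',h}(A)` for increasing `A`
  (Holley).
So the class `𝓗 = {h > 0 non-decreasing, log-convex}` — a convex cone containing `q^k` (`q ≥ 1`), `k!`, `2^{k²}`, all mixtures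
`∫ q^k dρ(q)` over `q ≥ 1` — shares the two FKG-type inputs of the `q ≥ 1` random-cluster theory.  CONTEXT (this seat's exact census,
bschramm/FROM-fk-1-g10-LEVELS.md §3): Kozma–Nitzan additive gluing holds under `μ_{w,h}` for EVERY positive `h` tested (fk-1 g9's node
`AdditiveGluingCountPos`), the chain links (GEN)/(AG-loc) exactly for the log-convex `h` tested (monotone or not), (S5) for the moment
sequences tested; FKG itself needs monotonicity as well (for `h` decreasing, e.g. `q < 1`, positive association fails).
[cite: Grimmett2006, Thm. (3.8) eqs. (3.11)–(3.12) (p. 39); Thm. (2.19), Thm. (2.24) (pp. 25–27); Thm. (3.21) (p. 43); §1.4 eq. (1.20) (p. 15)]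
-/

noncomputable section

namespace Summit.CriticalPhenomena.PercolationContinuityZ3.Theorems

namespace FK

open MeasureTheory Set Literature.Probability.LatticeModels Literature.Probability.Percolation
open scoped Classical
open BHK2006 DecisionTree

variable {V : Type*} [Fintype V]

/-! ### Log-convex non-decreasing sequences -/

omit [Fintype V] in
/-- For a positive log-convex sequence the ratios `h(j+1)/h(j)` are non-decreasing: `i ≤ j ⇒ h(i+1)h(j) ≤ h(i)h(j+1)`. [folklore] -/
theorem logConvex_ratio_le {h : ℕ → ℝ} (hpos : ∀ k, 0 < h k) (hlc : ∀ j, h (j + 1) * h (j + 1) ≤ h j * h (j + 2))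
    {i j : ℕ} (hij : i ≤ j) : h (i + 1) * h j ≤ h i * h (j + 1) := by
  induction j, hij using Nat.le_induction with
  | base => exact le_of_eq (by ring)
  | succ j hij ih =>
    -- `h(i+1)h(j)h(j+1) ≤ h(i)h(j+1)² ≤ h(i)h(j)h(j+2)`, cancel `h(j) > 0`
    have h1 : h (i + 1) * h (j + 1) * h j ≤ h i * h (j + 2) * h j := by
      calc h (i + 1) * h (j + 1) * h j = (h (i + 1) * h j) * h (j + 1) := by ring
        _ ≤ (h i * h (j + 1)) * h (j + 1) := mul_le_mul_of_nonneg_right ih (hpos _).le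
        _ = h i * (h (j + 1) * h (j + 1)) := by ring
        _ ≤ h i * (h j * h (j + 2)) := mul_le_mul_of_nonneg_left (hlc j) (hpos _).le
        _ = h i * h (j + 2) * h j := by ring
    exact le_of_mul_le_mul_right h1 (hpos j)

omit [Fintype V] in
/-- Shifting mass from the smaller to the larger index: `i ≤ j ⇒ h(i+d)h(j) ≤ h(i)h(j+d)`. [folklore] -/
theorem logConvex_shift_le {h : ℕ → ℝ} (hpos : ∀ k, 0 < h k) (hlc : ∀ j, h (j + 1) * h (j + 1) ≤ h j * h (j + 2))
    {i j : ℕ} (hij : i ≤ j) (d : ℕ) : h (i + d) * h j ≤ h i * h (j + d) := by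
  induction d generalizing i j with
  | zero => simp
  | succ d ih =>
    -- IH at `(i+1, j+1)`: `h(i+1+d)h(j+1) ≤ h(i+1)h(j+1+d)`; ratio step: `h(i+1)h(j) ≤ h(i)h(j+1)`
    have ih' := ih (Nat.succ_le_succ hij)
    have hr := logConvex_ratio_le hpos hlc hij
    have key : h (i + (d + 1)) * h j * h (j + 1) ≤ h i * h (j + (d + 1)) * h (j + 1) := by
      calc h (i + (d + 1)) * h j * h (j + 1) = (h (i + 1 + d) * h (j + 1)) * h j := by ring_nf
        _ ≤ (h (i + 1) * h (j + 1 + d)) * h j := mul_le_mul_of_nonneg_right ih' (hpos _).le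
        _ = (h (i + 1) * h j) * h (j + 1 + d) := by ring
        _ ≤ (h i * h (j + 1)) * h (j + 1 + d) := mul_le_mul_of_nonneg_right hr (hpos _).le
        _ = h i * h (j + (d + 1)) * h (j + 1) := by ring_nf
    exact le_of_mul_le_mul_right key (hpos _)

omit [Fintype V] in
/-- **The `h`-half of the lattice condition**: for `h` positive, non-decreasing and log-convex, `u ≤ m ≤ n` and `m + n ≤ u + v` give
`h(m)h(n) ≤ h(u)h(v)`. [folklore] -/
theorem logConvex_supermodular_le {h : ℕ → ℝ} (hpos : ∀ k, 0 < h k) (hmono : Monotone h)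
    (hlc : ∀ j, h (j + 1) * h (j + 1) ≤ h j * h (j + 2)) {u m n v : ℕ} (hum : u ≤ m) (hmn : m ≤ n) (hsum : m + n ≤ u + v) :
    h m * h n ≤ h u * h v := by
  obtain ⟨d, rfl⟩ := Nat.exists_eq_add_of_le hum
  have h1 := logConvex_shift_le hpos hlc (le_trans hum hmn) d
  -- `h(u+d)h(n) ≤ h(u)h(n+d)` and `n + d ≤ v`
  have hnd : n + d ≤ v := by omega
  calc h (u + d) * h n ≤ h u * h (n + d) := h1
    _ ≤ h u * h v := mul_le_mul_of_nonneg_left (hmono hnd) (hpos _).le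

/-! ### The lattice condition and positive association -/

omit [Fintype V] in
/-- The coordinates of `w` lie in `[0, 1]`. [folklore] -/
private theorem cw_nonneg (w : Sym2 V → unitInterval) (e : Sym2 V) : 0 ≤ (w e : ℝ) := (w e).2.1

omit [Fintype V] in
/-- The coordinates of `w` lie in `[0, 1]`. [folklore] -/
private theorem cw_le_one (w : Sym2 V → unitInterval) (e : Sym2 V) : (w e : ℝ) ≤ 1 := (w e).2.2

/-- **FKG lattice condition for `P_w·h(k)`**, `h` positive, non-decreasing, log-convex:
`μ(a)μ(b) ≤ μ(a ∩ b)μ(a ∪ b)`. [cite: Grimmett2006, Thm. (3.8) eqs. (3.11)–(3.12) (p. 39)] -/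
theorem crWeight_lattice_condition (w : Sym2 V → unitInterval) {h : ℕ → ℝ} (hpos : ∀ k, 0 < h k) (hmono : Monotone h)
    (hlc : ∀ j, h (j + 1) * h (j + 1) ≤ h j * h (j + 2)) (a b : BondConfig V) :
    crWeight w h a * crWeight w h b ≤ crWeight w h (a ⊓ b) * crWeight w h (a ⊔ b) := by
  unfold crWeight
  have hw := weight_inter_mul_union (fun e => (w e : ℝ)) a b
  have hk := clusterCount_supermodular a b (∅ : Set V)
  have h0 : 0 ≤ weight (fun e => (w e : ℝ)) (a ∩ b) * weight (fun e => (w e : ℝ)) (a ∪ b) :=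
    mul_nonneg (weight_nonneg (cw_nonneg w) (cw_le_one w) _) (weight_nonneg (cw_nonneg w) (cw_le_one w) _)
  -- the `h` factors: `k(a ∪ b) ≤ k(a), k(b) ≤ k(a ∩ b)` and `k(a) + k(b) ≤ k(a ∩ b) + k(a ∪ b)`
  have hh : h (clusterCount a ∅) * h (clusterCount b ∅) ≤ h (clusterCount (a ∩ b) ∅) * h (clusterCount (a ∪ b) ∅) := by
    have hua : clusterCount (a ∪ b) ∅ ≤ clusterCount a ∅ := clusterCount_anti Set.subset_union_left ∅
    have hub : clusterCount (a ∪ b) ∅ ≤ clusterCount b ∅ := clusterCount_anti Set.subset_union_right ∅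
    have hai : clusterCount a ∅ ≤ clusterCount (a ∩ b) ∅ := clusterCount_anti Set.inter_subset_left ∅
    have hbi : clusterCount b ∅ ≤ clusterCount (a ∩ b) ∅ := clusterCount_anti Set.inter_subset_right ∅
    rcases le_total (clusterCount a ∅) (clusterCount b ∅) with hab | hba
    · have := logConvex_supermodular_le hpos hmono hlc hua hab (by omega : clusterCount a ∅ + clusterCount b ∅ ≤
          clusterCount (a ∪ b) ∅ + clusterCount (a ∩ b) ∅)
      linarith [mul_comm (h (clusterCount (a ∪ b) ∅)) (h (clusterCount (a ∩ b) ∅))]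
    · have := logConvex_supermodular_le hpos hmono hlc hub hba (by omega : clusterCount b ∅ + clusterCount a ∅ ≤
          clusterCount (a ∪ b) ∅ + clusterCount (a ∩ b) ∅)
      linarith [mul_comm (h (clusterCount (a ∪ b) ∅)) (h (clusterCount (a ∩ b) ∅)),
        mul_comm (h (clusterCount a ∅)) (h (clusterCount b ∅))]
  have h0' : 0 ≤ h (clusterCount a ∅) * h (clusterCount b ∅) := mul_nonneg (hpos _).le (hpos _).le
  calc weight (fun e => (w e : ℝ)) a * h (clusterCount a ∅) * (weight (fun e => (w e : ℝ)) b * h (clusterCount b ∅))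
      = (weight (fun e => (w e : ℝ)) (a ∩ b) * weight (fun e => (w e : ℝ)) (a ∪ b)) *
          (h (clusterCount a ∅) * h (clusterCount b ∅)) := by rw [← hw]; ring
    _ ≤ (weight (fun e => (w e : ℝ)) (a ∩ b) * weight (fun e => (w e : ℝ)) (a ∪ b)) *
          (h (clusterCount (a ∩ b) ∅) * h (clusterCount (a ∪ b) ∅)) := mul_le_mul_of_nonneg_left hh h0
    _ = _ := by simp only [Set.inf_eq_inter, Set.sup_eq_union]; ring

/-- `μ_{w,h}(A) = (Σ_ω crWeight(ω)·1_A(ω)) / Z` for `h > 0`. [cite: Grimmett2006, §1.4 eq. (1.20) (p. 15)] -/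
theorem crMeasure_real_eq_sum_div (w : Sym2 V → unitInterval) {h : ℕ → ℝ} (hpos : ∀ k, 0 < h k) (A : Set (BondConfig V)) :
    (crMeasure w h).real A = (∑ ω : BondConfig V, crWeight w h ω * ind A ω) / crPartition w h := by
  have hZ := crPartition_pos w hpos
  have hnn : ∀ ω, 0 ≤ crWeight w h ω / crPartition w h * ind A ω := fun ω =>
    mul_nonneg (div_nonneg (crWeight_nonneg w (fun k => (hpos k).le) ω) hZ.le) (ind_nonneg _ _)
  have h1 : crMeasure w h A = ∑ ω : BondConfig V, ENNReal.ofReal (crWeight w h ω / crPartition w h * ind A ω) := by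
    simp only [crMeasure, Measure.coe_finsetSum, Measure.coe_smul, Finset.sum_apply, Pi.smul_apply, smul_eq_mul,
      Measure.dirac_apply, Set.indicator_apply, Pi.one_apply, mul_ite, mul_one, mul_zero]
    refine Finset.sum_congr rfl fun ω _ => ?_
    by_cases hω : ω ∈ A
    · rw [if_pos hω, ind_of_mem hω, mul_one]
    · rw [if_neg hω, ind_of_not_mem hω, mul_zero, ENNReal.ofReal_zero]
  rw [measureReal_def, h1, ← ENNReal.ofReal_sum_of_nonneg fun ω _ => hnn ω, ENNReal.toReal_ofReal (Finset.sum_nonneg fun ω _ => hnn ω),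
    Finset.sum_div]
  exact Finset.sum_congr rfl fun ω _ => by ring

omit [Fintype V] in
/-- The real indicator of an increasing event is monotone. [folklore] -/
private theorem ind_monotone_of_isUpperSet' {A : Set (BondConfig V)} (hA : IsUpperSet A) : Monotone (ind A) := by
  intro a b hab
  by_cases ha : a ∈ A
  · rw [ind_of_mem ha, ind_of_mem (hA hab ha)]
  · rw [ind_of_not_mem ha]; exact ind_nonneg A b

/-- **Positive association of `μ_{w,h}`** for `h` positive, non-decreasing, log-convex: increasing events are positively correlated,
`μ(A)μ(A') ≤ μ(A ∩ A')`.  For `h = q^k`, `q ≥ 1`, this is Grimmett's Thm. (3.8)(b). [cite: Grimmett2006, Thm. (3.8) (p. 39); Thm. (2.19) (p. 25)] -/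
theorem crMeasure_fkg (w : Sym2 V → unitInterval) {h : ℕ → ℝ} (hpos : ∀ k, 0 < h k) (hmono : Monotone h)
    (hlc : ∀ j, h (j + 1) * h (j + 1) ≤ h j * h (j + 2)) {A A' : Set (BondConfig V)} (hA : IsUpperSet A) (hA' : IsUpperSet A') :
    (crMeasure w h).real A * (crMeasure w h).real A' ≤ (crMeasure w h).real (A ∩ A') := by
  have hZ := crPartition_pos w hpos
  have key := fkg (μ := crWeight w h) (f := ind A) (g := ind A') (fun ω => crWeight_nonneg w (fun k => (hpos k).le) ω)
    (fun ω => ind_nonneg A ω) (fun ω => ind_nonneg A' ω) (ind_monotone_of_isUpperSet' hA) (ind_monotone_of_isUpperSet' hA')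
    (crWeight_lattice_condition w hpos hmono hlc)
  have hAA : ∀ ω, ind A ω * ind A' ω = ind (A ∩ A') ω := fun ω => (BHK2006.ind_inter A A' ω).symm
  simp only [hAA] at key
  rw [crMeasure_real_eq_sum_div w hpos A, crMeasure_real_eq_sum_div w hpos A', crMeasure_real_eq_sum_div w hpos (A ∩ A'),
    div_mul_div_comm, div_le_div_iff₀ (mul_pos hZ hZ) hZ]
  calc (∑ ω, crWeight w h ω * ind A ω) * (∑ ω, crWeight w h ω * ind A' ω) * crPartition w h
      ≤ (crPartition w h * ∑ ω, crWeight w h ω * ind (A ∩ A') ω) * crPartition w h := mul_le_mul_of_nonneg_right key hZ.le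
    _ = _ := by ring

/-! ### Comparison in the edge parameters -/

/-- **Holley's condition between `μ_{w,h}` and `μ_{w',h}` for `w ≤ w'`** (`h` positive, non-decreasing, log-convex).
[cite: Grimmett2006, Thm. (3.21) (proof) (p. 43); Thm. (2.1)] -/
theorem crWeight_holley_condition {w w' : Sym2 V → unitInterval} (hww : ∀ e, w e ≤ w' e) {h : ℕ → ℝ} (hpos : ∀ k, 0 < h k)
    (hmono : Monotone h) (hlc : ∀ j, h (j + 1) * h (j + 1) ≤ h j * h (j + 2)) (a b : BondConfig V) :
    crWeight w h a * crWeight w' h b ≤ crWeight w h (a ⊓ b) * crWeight w' h (a ⊔ b) := by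
  unfold crWeight
  have hprod : weight (fun e => (w e : ℝ)) a * weight (fun e => (w' e : ℝ)) b ≤
      weight (fun e => (w e : ℝ)) (a ⊓ b) * weight (fun e => (w' e : ℝ)) (a ⊔ b) := by
    unfold weight
    rw [← Finset.prod_mul_distrib, ← Finset.prod_mul_distrib]
    refine Finset.prod_le_prod (fun e _ => ?_) fun e _ => ?_
    · refine mul_nonneg ?_ ?_ <;> split_ifs <;> linarith [cw_nonneg w e, cw_le_one w e, cw_nonneg w' e, cw_le_one w' e]
    · have hwe : (w e : ℝ) ≤ w' e := hww e
      by_cases ha : e ∈ a <;> by_cases hb : e ∈ b <;>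
        simp only [ha, hb, Set.inf_eq_inter, Set.sup_eq_union, Set.mem_inter_iff, Set.mem_union, if_true, if_false, and_true,
          and_false, or_true, or_false, le_refl]
      nlinarith [cw_nonneg w e, cw_le_one w' e]
  have hk := clusterCount_supermodular a b (∅ : Set V)
  have hh : h (clusterCount a ∅) * h (clusterCount b ∅) ≤ h (clusterCount (a ⊓ b) ∅) * h (clusterCount (a ⊔ b) ∅) := by
    have hua : clusterCount (a ∪ b) ∅ ≤ clusterCount a ∅ := clusterCount_anti Set.subset_union_left ∅
    have hub : clusterCount (a ∪ b) ∅ ≤ clusterCount b ∅ := clusterCount_anti Set.subset_union_right ∅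
    simp only [Set.inf_eq_inter, Set.sup_eq_union]
    rcases le_total (clusterCount a ∅) (clusterCount b ∅) with hab | hba
    · have := logConvex_supermodular_le hpos hmono hlc hua hab (by omega : clusterCount a ∅ + clusterCount b ∅ ≤
          clusterCount (a ∪ b) ∅ + clusterCount (a ∩ b) ∅)
      linarith [mul_comm (h (clusterCount (a ∪ b) ∅)) (h (clusterCount (a ∩ b) ∅))]
    · have := logConvex_supermodular_le hpos hmono hlc hub hba (by omega : clusterCount b ∅ + clusterCount a ∅ ≤
          clusterCount (a ∪ b) ∅ + clusterCount (a ∩ b) ∅)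
      linarith [mul_comm (h (clusterCount (a ∪ b) ∅)) (h (clusterCount (a ∩ b) ∅)),
        mul_comm (h (clusterCount a ∅)) (h (clusterCount b ∅))]
  have h0 : 0 ≤ weight (fun e => (w e : ℝ)) (a ⊓ b) * weight (fun e => (w' e : ℝ)) (a ⊔ b) :=
    mul_nonneg (weight_nonneg (cw_nonneg w) (cw_le_one w) _) (weight_nonneg (cw_nonneg w') (cw_le_one w') _)
  have h0' : 0 ≤ h (clusterCount a ∅) * h (clusterCount b ∅) := mul_nonneg (hpos _).le (hpos _).le
  calc weight (fun e => (w e : ℝ)) a * h (clusterCount a ∅) * (weight (fun e => (w' e : ℝ)) b * h (clusterCount b ∅))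
      = (weight (fun e => (w e : ℝ)) a * weight (fun e => (w' e : ℝ)) b) * (h (clusterCount a ∅) * h (clusterCount b ∅)) := by ring
    _ ≤ (weight (fun e => (w e : ℝ)) (a ⊓ b) * weight (fun e => (w' e : ℝ)) (a ⊔ b)) *
          (h (clusterCount (a ⊓ b) ∅) * h (clusterCount (a ⊔ b) ∅)) := mul_le_mul hprod hh h0' h0
    _ = _ := by ring

/-- **Comparison in the edge parameters for `μ_{w,h}`** (`h` positive, non-decreasing, log-convex): `w ≤ w'` pointwise ⇒
`μ_{w,h}(A) ≤ μ_{w',h}(A)` for every increasing event `A` (Holley).  For `h = q^k`, `q ≥ 1`: Grimmett's Thm. (3.21) in `𝐩`.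
[cite: Grimmett2006, Thm. (3.21), eq. (3.22) (p. 43); Thm. (2.1) (p. 20)] -/
theorem crMeasure_real_mono_weights {w w' : Sym2 V → unitInterval} (hww : ∀ e, w e ≤ w' e) {h : ℕ → ℝ} (hpos : ∀ k, 0 < h k)
    (hmono : Monotone h) (hlc : ∀ j, h (j + 1) * h (j + 1) ≤ h j * h (j + 2)) {A : Set (BondConfig V)} (hA : IsUpperSet A) :
    (crMeasure w h).real A ≤ (crMeasure w' h).real A := by
  have hZ₁ := crPartition_pos w hpos
  have hZ₂ := crPartition_pos w' hpos
  set f : BondConfig V → ℝ := fun ω => crWeight w h ω / crPartition w h with hf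
  set g : BondConfig V → ℝ := fun ω => crWeight w' h ω / crPartition w' h with hg
  have hf0 : 0 ≤ f := fun ω => div_nonneg (crWeight_nonneg w (fun k => (hpos k).le) ω) hZ₁.le
  have hg0 : 0 ≤ g := fun ω => div_nonneg (crWeight_nonneg w' (fun k => (hpos k).le) ω) hZ₂.le
  have hfg : ∑ ω, f ω = ∑ ω, g ω := by
    simp only [hf, hg, ← Finset.sum_div]
    change crPartition w h / _ = crPartition w' h / _
    rw [div_self hZ₁.ne', div_self hZ₂.ne']
  have hcond : ∀ a b, f a * g b ≤ f (a ⊓ b) * g (a ⊔ b) := fun a b => by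
    simp only [hf, hg, div_mul_div_comm]
    exact div_le_div_of_nonneg_right (crWeight_holley_condition hww hpos hmono hlc a b) (mul_pos hZ₁ hZ₂).le
  have key := holley (μ := ind A) f g (fun ω => ind_nonneg A ω) hf0 hg0 (ind_monotone_of_isUpperSet' hA) hfg hcond
  rw [crMeasure_real_eq_sum_div w hpos A, crMeasure_real_eq_sum_div w' hpos A, Finset.sum_div, Finset.sum_div]
  calc ∑ ω, crWeight w h ω * ind A ω / crPartition w h = ∑ ω, ind A ω * f ω :=
        Finset.sum_congr rfl fun ω _ => by simp only [hf]; ring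
    _ ≤ ∑ ω, ind A ω * g ω := key
    _ = _ := Finset.sum_congr rfl fun ω _ => by simp only [hg]; ring

/-- Sanity: `q^k` with `q ≥ 1` is positive, non-decreasing and log-convex, so `φ_{w,q}` (`q ≥ 1`) lies in the class.
[cite: Grimmett2006, Thm. (3.8) (p. 39)] -/
theorem pow_mem_logConvexClass {q : ℝ} (hq : 1 ≤ q) :
    (∀ k, 0 < q ^ k) ∧ Monotone (fun k : ℕ => q ^ k) ∧ (∀ j : ℕ, q ^ (j + 1) * q ^ (j + 1) ≤ q ^ j * q ^ (j + 2)) := by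
  refine ⟨fun k => pow_pos (by linarith) k, fun a b hab => pow_le_pow_right₀ hq hab, fun j => ?_⟩
  rw [← pow_add, ← pow_add]
  exact le_of_eq (by ring_nf)

end FK

end Summit.CriticalPhenomena.PercolationContinuityZ3.Theorems

end
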